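import Summits.CriticalPhenomena.PercolationContinuityZ3.Theorems.Transplant.KNCellsReachO
import Summits.CriticalPhenomena.PercolationContinuityZ3.Theorems.Transplant.KNCellsReach
import Summits.CriticalPhenomena.PercolationContinuityZ3.Theorems.Transplant.BoxProdZ2Defs
import Summits.CriticalPhenomena.PercolationContinuityZ3.Theorems.Transplant.KNCellsSchemeO
import Summits.CriticalPhenomena.PercolationContinuityZ3.Theorems.Transplant.KNCellsProcessO
import Summits.CriticalPhenomena.PercolationContinuityZ3.Theorems.Transplant.KNCellsRunO
import Summits.CriticalPhenomena.PercolationContinuityZ3.Theorems.Transplant.KNCellsRunInvO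
import Summits.CriticalPhenomena.PercolationContinuityZ3.Theorems.Transplant.KNCellsCoverO
import Summits.CriticalPhenomena.PercolationContinuityZ3.Theorems.Transplant.KNCellsExit
import Literature.Probability.Percolation.OrientedHistorySiteRenormalizationRun
import HarnessLib

/-!
# N2 (frames-only node `SamePDropOfSkeletonFrm₁`, OPEN) — ORIENTED MACRO LAYER (WAVE 0 (c1), (R-18) `q ≡ true`): the oriented twin of N1's `KNCellsExit`

builds on p205010 (kernel theorem, internal audit signed; external expert review pending) — nothing in this file uses p205010; NOTHING is claimed about the
open node `SamePDropOfSkeletonFrm₁` (`SamePDropOfSkeletonNeg₁` is CLOSED in the tree and untouched by this file).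
Status sentence (coordinator 2026-08-20T04:30Z): "θ(p_c) = 0 on ℤ^d, all d ≥ 2 — kernel-verified (Lean 4/Mathlib, standard axioms); internal adversarial
audit SIGNED 2026-08-20 04:29Z; external expert review pending."
Lane `prim-bschramm-*`, seat `prim-bschramm-stmt` (gen 19); helper file (`--supports stmt-CriticalPhenomena-4575 --as helper`); N2-SCOPE §20, (R-18)/(R-19).
PORT RULES (HOME/prim-bschramm-stmt-g19/lean/port_orient.py): the history-site API is replaced by its ORIENTED twin at the fixed quadrant `qNE := fun _ => true`
(`HState.choice ↦ HState.ochoice qNE`, `mstOf ↦ omstOf qNE`, `mst/stN ↦ omst/ostN qNE`, `occFinal ↦ ooccFinal qNE`, `Lawful ↦ OLawful qNE`, onward directions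
`onward ↦ onwardO` = the POSITIVE ones, (N2-e)); every declaration whose text changes thereby — directly or through a changed declaration — is re-declared with the
suffix `O` (same namespace); unchanged declarations of the N1 file are NOT repeated (the N1 module is imported). Docstrings/citations are N1's.
N1 HEADER (kept for the reader):
* §1 `ExitGeom G Γ` — the last geometric facts: `M ⊆ Q`, cells of other macro-vertices and all zones miss every cube, and LOCAL FINITENESS
  of the edge regions seen from a vertex (a vertex is adjacent to `E_{w,v}` for boundedly many macro-targets `v`, whatever the anchors —
  KN: "within `16r` of the centre of `v`", `finite_setOf_near`);
* §2 **`exists_exit`** — after a valid history the configuration itself has an open path inside the explored region from the root to a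
  `G`-neighbour of `E_{w,v}` ((32) is a positive probability under the weighting pinned on the recorded pattern);
  **`mem_percolatesAt_of_infinite`** — an infinite macro-cluster forces an infinite open cluster of the root (the fifth conjunct);
* §3 **`card_env_le`** — after a valid history the envelope has at most `Δ · B` edges (`Δ` a degree bound, `B` a bound on the envelope
  regions: fresh edges touch the envelope region);
* §4 **`samePWitnessAt_of_cells`** — THE ASSEMBLY: an anchored cell geometry with `RunGeom`/`SepGeom`/`ExitGeom`, a degree bound, an
  envelope-region bound, `δ ≤ 1`, (32) at the root cell (`hQ0`, the scale choice) and the failure bound (33) after valid histories with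
  `ε < 2⁻³²` (`hfail`, the Steps files) give `SameP.SamePWitnessAt G root p`.
[cite: KozmaNitzan2024, §4 pp. 25–31 ((3), (32), proof of Theorem 6) — the ℤ^d model] [cite: GrimmettPercolation1999, §7.2]
-/
noncomputable section

open MeasureTheory ProbabilityTheory
open scoped ENNReal Classical

namespace Summit.CriticalPhenomena.PercolationContinuityZ3.Theorems

namespace Transplant

namespace KNCells

open Literature.Probability.Percolation Literature.Probability.LatticeModels SimpleGraph GadgetSystem ProbeHistory HSiteScheme Contour

variable {V : Type*} [DecidableEq V] [Countable V]

/-! ## §1 The last geometric facts -/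

namespace KSchA

variable {A : Type*} {G : SimpleGraph V} [G.LocallyFinite] {S : KSchA V A}
variable (hΓ : RunGeom G S.Γ) (hsep : SepGeom G S.Γ) (hX : ExitGeom G S.Γ) {ω : BondConfig V}
include hΓ hsep hX

/-! ## §2 What an occupied macro-vertex certifies -/

omit [Countable V] hΓ hsep in
/-- The explored region of a valid history misses the cube of the target (any anchor). [cite: KozmaNitzan2024, §4 p. 26 ((29))] -/
theorem ValidO.not_mem_Q_tgt {h : ProbeHistory V} {e : Site 2 × MDir} (hV : S.ValidO G h e) {a : A} {y : V} (hy : y ∈ S.Vx G h) :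
    y ∉ S.Γ.Q a (tgt e) := by
  obtain ⟨det, hv, -, hsub⟩ := hV.cover
  have hy' := hsub (Finset.mem_coe.2 hy)
  simp only [CellGeom.Cover, Set.mem_iUnion, Set.mem_union, exists_prop, Finset.mem_coe] at hy'
  obtain ⟨u, hu, h' | ⟨δ, h'⟩⟩ := hy'
  · have hux : u ≠ tgt e := fun h'' => hv (h'' ▸ hu)
    exact Finset.disjoint_left.1 (hX.Cell_disjoint_Q _ _ _ _ hux) h'
  · exact Finset.disjoint_left.1 (hX.Zone_disjoint_Q _ _ _ _ _) h'

omit hsep in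
/-- **The certificate of (32)** (KN p. 26, (3)): after a valid history the configuration itself has an open path inside the explored region
from the root to a `G`-neighbour of `E_{w,v}` (at the source's departure anchor) — (32) is a positive probability under the weighting pinned
on the recorded pattern, which on the initial event is the configuration's own. [cite: KozmaNitzan2024, §4 p. 26 ((3)) and p. 28 ((32))] -/
theorem exists_exitO (hδc : S.δc ≤ 1) (hA : ω ∈ initEvent (S.schemeO G))
    {n : ℕ} {e : Site 2 × MDir} (hV : S.ValidO G (S.hstO G ω n) e) :
    ∃ a ∈ S.Vx G (S.hstO G ω n), PathIn (openGraph ω) (↑(S.Vx G (S.hstO G ω n)) : Set V) S.Γ.root a ∧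
      ∃ b ∈ S.Γ.Ewv (S.aOfO G (S.hstO G ω n) e) e.1 e.2, G.Adj a b := by
  set aa := S.aOfO G (S.hstO G ω n) e with haa
  set W := S.W₀ G (S.hstO G ω n) e aa with hW
  have hI := runInvO hΓ ω n
  have hpos : 0 < (prodBernoulli W).real (⋃ t ∈ S.Γ.M aa (tgt e), openConn S.Γ.root t) :=
    lt_of_le_of_lt (by linarith) hV.reach
  -- almost surely no pair of weight zero is open
  have hae : ∀ᵐ η ∂prodBernoulli W, ∀ x ∈ {x : Sym2 V | W x = 0}, x ∉ η :=
    prodBernoulli_ae_forall_notMem _ (Set.to_countable _) fun x hx => hx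
  have hne : ((⋃ t ∈ S.Γ.M aa (tgt e), openConn S.Γ.root t) ∩ {η | ∀ x : Sym2 V, W x = 0 → x ∉ η}).Nonempty := by
    by_contra h
    rw [Set.not_nonempty_iff_eq_empty] at h
    have h1 : (prodBernoulli W).real ((⋃ t ∈ S.Γ.M aa (tgt e), openConn S.Γ.root t) ∩
        {η | ∀ x : Sym2 V, W x = 0 → x ∉ η}) = (prodBernoulli W).real (⋃ t ∈ S.Γ.M aa (tgt e), openConn S.Γ.root t) := by
      refine measureReal_congr ?_
      filter_upwards [hae] with η hη
      exact propext ⟨fun h' => h'.1, fun h' => ⟨h', fun x hx => hη x hx⟩⟩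
    rw [h, measureReal_empty] at h1
    linarith
  obtain ⟨η, hηA, hη0⟩ := hne
  simp only [Set.mem_iUnion, exists_prop] at hηA
  obtain ⟨t, ht, hreach⟩ := hηA
  have hopen : ∀ x y, (openGraph η).Adj x y → W s(x, y) ≠ 0 := fun x y hxy h0 =>
    hη0 _ h0 ((openGraph_adj _ _ _).1 hxy).1
  -- the open path from the root to `M_v` inside `E_i ∪ E_{w,v}` and its first exit from `E_i`
  have hηwire : ∀ x ∈ η, x ∈ wireSet (↑(S.Vx G (S.hstO G ω n) ∪ S.Γ.Ewv aa e.1 e.2) : Set V) := by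
    intro x hx
    by_contra hxS
    exact hη0 x (by rw [hW, W₀]; exact restrW_apply_of_not_mem _ hxS) hx
  have hpath := pathIn_of_reachable_of_forall_mem_wireSet hηwire
    (Finset.mem_coe.2 (Finset.mem_union_left _ hV.root_mem)) hreach
  have htV : t ∉ (↑(S.Vx G (S.hstO G ω n)) : Set V) := fun h =>
    ValidO.not_mem_Q_tgt hX hV (Finset.mem_coe.1 h) (hX.M_subset_Q _ _ ht)
  obtain ⟨a, b, ha, hb, hbU, hab, hpa⟩ := hpath.exit (R := (↑(S.Vx G (S.hstO G ω n)) : Set V))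
    (Finset.mem_coe.2 hV.root_mem) htV
  have hbE : b ∈ S.Γ.Ewv aa e.1 e.2 := by
    rcases Finset.mem_union.1 (Finset.mem_coe.1 hbU) with h | h
    · exact absurd (Finset.mem_coe.2 h) hb
    · exact h
  have haU : a ∈ (↑(S.Vx G (S.hstO G ω n) ∪ S.Γ.Ewv aa e.1 e.2) : Set V) :=
    Finset.mem_coe.2 (Finset.mem_union_left _ (Finset.mem_coe.1 ha))
  -- the exit edge is an edge of `G`
  have hab' : G.Adj a b := by
    have h1 := hopen a b hab
    rw [hW, W₀, restrW_apply_of_mem _ (mk_mem_wireSet_iff.2 ⟨haU, hbU, hab.ne⟩)] at h1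
    have hF : s(a, b) ∉ (↑(S.F G (S.hstO G ω n)) : Set (Sym2 V)) := by
      intro h
      rw [Finset.mem_coe, hI.F_eq, mem_edgesIn_iff] at h
      exact hb (Finset.mem_coe.2 (h.2 b (Sym2.mem_mk_right _ _)))
    rw [pinW_apply_of_not_mem _ _ hF] at h1
    by_contra hnadj
    exact h1 (KNLevels.lattW_mk_of_not_adj G S.p hnadj)
  -- the initial segment is `ω`-open
  have hpa' : PathIn (openGraph ω) (↑(S.Vx G (S.hstO G ω n)) : Set V) S.Γ.root a := by
    refine (DCT16.pathIn_congrGraph (fun x y hx hy hxy => ?_) hpa).mono Set.inter_subset_left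
    have hxV : x ∈ S.Vx G (S.hstO G ω n) := Finset.mem_coe.1 hx.1
    have hyV : y ∈ S.Vx G (S.hstO G ω n) := Finset.mem_coe.1 hy.1
    have h1 := hopen x y hxy
    have hne := hxy.ne
    rw [hW, W₀, restrW_apply_of_mem _ (mk_mem_wireSet_iff.2 ⟨hx.2, hy.2, hne⟩)] at h1
    by_cases hF : s(x, y) ∈ (↑(S.F G (S.hstO G ω n)) : Set (Sym2 V))
    · have hξ : s(x, y) ∈ (↑(S.ξ G (S.hstO G ω n)) : Set (Sym2 V)) := by
        by_contra hξ
        rw [pinW_apply_of_mem_of_not_mem _ hF hξ] at h1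
        exact h1 rfl
      rw [openGraph_adj]
      rcases ((hI.ξ_iff _).1 (Finset.mem_coe.1 hξ)).2 with h | h
      · exact ⟨h, hne⟩
      · exact ⟨hA (Finset.mem_coe.2 h), hne⟩
    · exfalso
      rw [pinW_apply_of_not_mem _ _ hF] at h1
      by_cases hadj : G.Adj x y
      · apply hF
        rw [Finset.mem_coe, hI.F_eq, mem_edgesIn_iff]
        refine ⟨(SimpleGraph.mem_edgeSet _).2 hadj, fun z hz => ?_⟩
        rcases Sym2.mem_iff.1 hz with rfl | rfl
        · exact hxV
        · exact hyV
      · exact h1 (KNLevels.lattW_mk_of_not_adj G S.p hadj)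
  exact ⟨a, Finset.mem_coe.1 ha, hpa', b, hbE, hab'⟩

omit hsep in
/-- **An infinite macro-cluster forces an infinite open cluster of the root** (KN pp. 26–27: "the combination of (2) and (3)"): every
occupied macro-vertex `v ≠ 0` was examined after a valid history, whose certificate is a vertex of the root's cluster adjacent to the edge
region `E_{w,v}`; a vertex is adjacent to the edge regions of boundedly many macro-targets. [cite: KozmaNitzan2024, §4 pp. 26–27] -/
theorem mem_percolatesAt_of_infiniteO (hδc : S.δc ≤ 1) (hA : ω ∈ initEvent (S.schemeO G))
    (hinf : ((S.schemeO G).ooccFinal qNE ω).Infinite) : ω ∈ percolatesAt S.Γ.root := by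
  set Cl := openCluster ω S.Γ.root with hCl
  have hnear : ∀ v ∈ (S.schemeO G).ooccFinal qNE ω, v ≠ 0 →
      ∃ y ∈ Cl, v ∈ {v : Site 2 | ∃ (a : A) (w : Site 2) (δ : MDir), w + stepVec δ = v ∧ ∃ b ∈ S.Γ.Ewv a w δ, G.Adj y b} := by
    intro v hv hv0
    obtain ⟨n, hvn⟩ := Set.mem_iUnion.1 hv
    rcases (S.schemeO G).exists_probe_of_det_oriented qNE ω n v (Or.inl hvn) with h | ⟨m, -, e, P, hc, hte, hP, -⟩
    · exact absurd h hv0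
    obtain ⟨e', hc', hV, rfl⟩ := S.of_next_someO hP
    rw [hc] at hc'
    cases Option.some_injective _ hc'
    obtain ⟨y, -, hpa, b, hb, hyb⟩ := exists_exitO hΓ hX hδc hA hV
    refine ⟨y, DCT16.reachable_of_pathIn hpa, ?_⟩
    exact ⟨S.aOfO G (S.hstO G ω m) e, e.1, e.2, hte, b, hb, hyb⟩
  by_contra hfin
  have hClfin : Cl.Finite := Set.not_infinite.1 hfin
  have hF : (⋃ y ∈ Cl, {v : Site 2 | ∃ (a : A) (w : Site 2) (δ : MDir), w + stepVec δ = v ∧ ∃ b ∈ S.Γ.Ewv a w δ, G.Adj y b}).Finite :=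
    hClfin.biUnion fun y _ => hX.locFin y
  refine hinf ((hF.union (Set.finite_singleton 0)).subset fun v hv => ?_)
  by_cases hv0 : v = 0
  · exact Or.inr hv0
  · obtain ⟨y, hy, hnr⟩ := hnear v hv hv0
    exact Or.inl (Set.mem_biUnion hy hnr)

/-! ## §3 The envelope bound -/

omit [Countable V] hΓ hsep hX in
/-- **After a valid history the envelope of the examination has at most `Δ · B` edges**: the explored edges are exactly the edges of `G`
inside the explored region (`ValidO.F_eq`), so a fresh edge of the envelope touches the envelope region, of at most `B` vertices.
[cite: KozmaNitzan2024, §4 p. 27 (E_{i+1})] -/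
theorem card_env_leO {Δ B : ℕ} (hΔ : ∀ x, G.degree x ≤ Δ)
    (hB : ∀ (h : ProbeHistory V) (e : Site 2 × MDir) (a : A), (S.envRegionO G h e a).card ≤ B)
    {h : ProbeHistory V} {e : Site 2 × MDir} (hV : S.ValidO G h e) (a : A) :
    (S.envO G h e a).card ≤ Δ * B := by
  have hsub : S.envO G h e a ⊆ edgesTouching G (S.envRegionO G h e a) := by
    intro x hx
    rw [KSchA.envO, Finset.mem_sdiff, hV.F_eq] at hx
    obtain ⟨hx1, hx2⟩ := hx
    rw [mem_edgesIn_iff] at hx1 hx2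
    rw [mem_edgesTouching_iff]
    refine ⟨hx1.1, ?_⟩
    by_contra hcon
    push Not at hcon
    exact hx2 ⟨hx1.1, fun z hz => (Finset.mem_union.1 (hx1.2 z hz)).resolve_right fun hzR => hcon z hzR hz⟩
  calc (S.envO G h e a).card ≤ (edgesTouching G (S.envRegionO G h e a)).card := Finset.card_le_card hsub
    _ ≤ ∑ x ∈ S.envRegionO G h e a, (G.incidenceFinset x).card := Finset.card_biUnion_le
    _ ≤ ∑ _x ∈ S.envRegionO G h e a, Δ := Finset.sum_le_sum fun x _ => by
        rw [SimpleGraph.card_incidenceFinset_eq_degree]; exact hΔ x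
    _ = Δ * (S.envRegionO G h e a).card := by rw [Finset.sum_const, smul_eq_mul, mul_comm]
    _ ≤ Δ * B := Nat.mul_le_mul_left _ (hB h e a)

/-! ## §4 The assembly: the five conjuncts of `SameP.SamePWitnessAt` -/

end KSchA

end KNCells

end Transplant

end Summit.CriticalPhenomena.PercolationContinuityZ3.Theorems

end
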